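import Mathlib
import Summits.ResolutionOfSingularities.ResolutionOfSingularities.Theorems.HomologicalConductorNoZenoStableAnnihilatorReduction
import Summits.ResolutionOfSingularities.ResolutionOfSingularities.Theorems.HomologicalConductorNoZenoReflexiveSyzygy
import HarnessLib

/-!
# Crux `NoZenoR` / `NoZeno` (stmt-ResolutionOfSingularities-19943 / -16483), line
# `sandwich-cluster`, S3 Layer 2 — CA-layer III: **CA4, the assembly**
# (`caⁿ(T)` = stable annihilator of the DUALS of the `(n-1)`-st syzygies)

Route `ResolutionOfSingularities/HomologicalConductor`.  OURS (cell res-hironaka, crux chain W4.4,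
seat res-L0-w44-stub-7 = res-D-pv-039); nothing here is a statement of the manuscript under review
(Hironaka 2017); pure commutative algebra; AI-written, weaker than expert review.

CRUX-PLAN W4.4 v5/v6 §A item CA4 (planner res-L0-w44-plan-1, `SketchCALayer.lean` rev 2; tri-1
A-AUDIT TRIAGE v4 §7, 6/6 PASS, finding F1).  THEOREM A at sky points (`stub_skyPrincipal`, G4)
consumes the cohomology annihilator in the form

  `x ∈ caⁿ(T) ↔ ∀ M L, M f.g. → L ∈ Ωⁿ⁻¹(M) → x ∈ s̲ann(L*)`.

This is CA1 (reduction lemma, stub-5 p497920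
`mem_cohomologyAnnihilatorOfDegree_succ_iff_forall_isSyzygy`) at degree `n - 1`, followed by CA3
(`stablyAnnihilates_iff_dual`, same file) on each `L`, which is REFLEXIVE by CA0 (res-D-pv-043
p497661 `isReflexive_of_isSyzygy_two`) because an `(n-1)`-st syzygy with `n ≥ 3` is a second
syzygy (`exists_isSyzygy_two_of_two_le`, peeling first syzygies off the `M` end).  Hence CA4 holds
over any noetherian DOMAIN for `n ≥ 3`; the typed sketch's `IsLocalRing`, `IsIntegrallyClosed`,
`ringKrullDim T = 2`, `4 ≤ n` are idle and kept only in the verbatim corollary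
`mem_cohomologyAnnihilatorOfDegree_iff_forall_dual_syzygy_of_isIntegrallyClosed`.  The RIDER
«each `L*` has `Ext¹(L*, T) = 0`, valid for `n ≥ 4` only» (tri-1 F1; CA0 + CA2 + CA3) is NOT part
of CA4 — it lives in G4 (CHAIN v6 §2 row stub-7).
-/

noncomputable section

-- single-problem summit: the doubled namespace component `ResolutionOfSingularities` is forced
set_option linter.dupNamespace false

namespace Summit.ResolutionOfSingularities.ResolutionOfSingularities.Theorems.NoZeno.SandwichCluster

open CategoryTheory Literature.RingTheory.CohomologyAnnihilator

universe u

variable {T : Type u} [CommRing T]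

/-! ## Peeling: high syzygies are second syzygies -/

/-- Peeling first syzygies off the `M` end: an `s`-th syzygy module with `s ≥ 2` is a second
syzygy module (of an `(s-2)`-nd syzygy of the original module). [folklore] -/
theorem exists_isSyzygy_two_of_two_le {M K : ModuleCat.{u} T} :
    ∀ {s : ℕ}, 2 ≤ s → IsSyzygy s M K → ∃ M' : ModuleCat.{u} T, IsSyzygy 2 M' K
  | 0, h, _ => absurd h (by omega)
  | 1, h, _ => absurd h (by omega)
  | 2, _, hK => ⟨M, hK⟩
  | s + 3, _, hK => by
    obtain ⟨M', -, hK'⟩ := (isSyzygy_succ_iff_exists_first (s := s + 2)).mp hK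
    exact exists_isSyzygy_two_of_two_le (M := M') (by omega) hK'

/-- Over a domain every `s`-th syzygy module with `s ≥ 2` is REFLEXIVE (CA0
`isReflexive_of_isSyzygy_two` of res-D-pv-043's p497661 + peeling). [folklore] -/
theorem isReflexive_of_isSyzygy_of_two_le [IsDomain T] {M K : ModuleCat.{u} T} {s : ℕ}
    (hs : 2 ≤ s) (hK : IsSyzygy s M K) : Module.IsReflexive T K := by
  obtain ⟨M', hK'⟩ := exists_isSyzygy_two_of_two_le hs hK
  exact isReflexive_of_isSyzygy_two M' K hK'

/-! ## CA4 -/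

/-- **CA4** (CRUX-PLAN W4.4 v5/v6 §A; assembly of the CA-layer, the form THEOREM A consumes):
over a noetherian DOMAIN `T` and for `n ≥ 3`, `x ∈ caⁿ(T)` iff `x` stably annihilates the DUAL
`L* = Hom(L, T)` of every `(n-1)`-st syzygy module `L` of every finitely generated module `M` —
CA1 (`mem_cohomologyAnnihilatorOfDegree_succ_iff_forall_isSyzygy`, degree `n - 1`) and, for each
such `L`, CA3 (`stablyAnnihilates_iff_dual`), `L` being reflexive by CA0 since `n - 1 ≥ 2`
(`isReflexive_of_isSyzygy_of_two_le`). [folklore] -/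
theorem mem_cohomologyAnnihilatorOfDegree_iff_forall_dual_syzygy [IsNoetherianRing T] [IsDomain T]
    {n : ℕ} (hn : 3 ≤ n) (x : T) :
    x ∈ cohomologyAnnihilatorOfDegree T n ↔
      ∀ (M L : ModuleCat.{u} T), Module.Finite T M → IsSyzygy (n - 1) M L →
        StablyAnnihilates T x (ModuleCat.of T (Module.Dual T L)) := by
  obtain ⟨m, rfl⟩ : ∃ m, n = m + 1 := ⟨n - 1, by omega⟩
  rw [Nat.add_sub_cancel, mem_cohomologyAnnihilatorOfDegree_succ_iff_forall_isSyzygy]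
  refine forall₄_congr fun M L _ hL => ?_
  exact stablyAnnihilates_iff_dual x L (isReflexive_of_isSyzygy_of_two_le (by omega) hL)

/-- CA4 with the planner's typed signature VERBATIM (`SketchCALayer.lean` rev 2: two-dimensional
noetherian local normal domain, `4 ≤ n`); the hypotheses beyond «noetherian domain, `3 ≤ n`» are
idle and kept for the consumer (G4 takes `n ≥ max s 4`, tri-1 F1). [folklore] -/
theorem mem_cohomologyAnnihilatorOfDegree_iff_forall_dual_syzygy_of_isIntegrallyClosed
    [IsNoetherianRing T] [IsLocalRing T] [IsDomain T] [IsIntegrallyClosed T]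
    (_hdim : ringKrullDim T = 2) {n : ℕ} (hn : 4 ≤ n) (x : T) :
    x ∈ cohomologyAnnihilatorOfDegree T n ↔
      ∀ (M L : ModuleCat.{u} T), Module.Finite T M → IsSyzygy (n - 1) M L →
        StablyAnnihilates T x (ModuleCat.of T (Module.Dual T L)) :=
  mem_cohomologyAnnihilatorOfDegree_iff_forall_dual_syzygy (by omega) x

/-- The same at the level of the full cohomology annihilator `ca(T) = ⋃ₙ caⁿ(T)`: over a
noetherian domain, `x ∈ ca(T)` iff for SOME `n ≥ 3`, `x` stably annihilates the dual of every
`(n-1)`-st syzygy of every finitely generated module (stub-5's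
`mem_cohomologyAnnihilator_iff_exists_forall_isSyzygy` + CA4; the degree can be pushed up along
`cohomologyAnnihilatorOfDegree_mono`). [folklore] -/
theorem mem_cohomologyAnnihilator_iff_exists_forall_dual_syzygy [IsNoetherianRing T] [IsDomain T]
    (x : T) :
    x ∈ cohomologyAnnihilator T ↔ ∃ n : ℕ, 3 ≤ n ∧
      ∀ (M L : ModuleCat.{u} T), Module.Finite T M → IsSyzygy (n - 1) M L →
        StablyAnnihilates T x (ModuleCat.of T (Module.Dual T L)) := by
  rw [mem_cohomologyAnnihilator_iff]
  constructor
  · rintro ⟨n, hn⟩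
    refine ⟨n + 3, by omega, ?_⟩
    exact (mem_cohomologyAnnihilatorOfDegree_iff_forall_dual_syzygy (by omega) x).mp
      (cohomologyAnnihilatorOfDegree_mono (by omega) hn)
  · rintro ⟨n, hn, h⟩
    exact ⟨n, (mem_cohomologyAnnihilatorOfDegree_iff_forall_dual_syzygy hn x).mpr h⟩

end Summit.ResolutionOfSingularities.ResolutionOfSingularities.Theorems.NoZeno.SandwichCluster
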